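import Literature.NumberTheory.PAdicHodge.AinfRamifiedOmegaPeriodVanishing
import Literature.NumberTheory.PAdicHodge.AinfRamifiedPTorsionZero
import HarnessLib

/-!
# (N1′) over the ramified base: `∫_t ω ≠ 0` for every Tate-module point `t` of `Ŵ(𝒪_{ℂ_F})` with `t₁ ≠ 0`, at supersingular
# reduction of a Weierstrass equation over `𝒪_D = ℤ_p[ϖ]`

Topic `Literature/NumberTheory/PAdicHodge`; THEOREMS ONLY. Assembly of the ramified (L1′) (`AinfRamifiedOmegaPeriodVanishing`:
`∫_t ω = 0 ⟹ [t] = 0`) and (L2′) (`AinfRamifiedPTorsionZero`: `[p]T = 0 ⟹ T = 0` on `Ŵ(𝔫_𝒪)` under the supersingular shape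
`[p] = p·X·R + X^{p²}·S`), with two new links:

* §1 `theta_torsionLift_eq` — **`θ_𝒪([t]) = t₀`** for EVERY `[p]`-compatible sequence `t` (continuity of `θ_𝒪`; `[pⁿ]tₙ = t₀`);
* §2 `mulP_torsionLift_shift` — **`[p]·[t⁺] = [t]`** for the shifted sequence `t⁺ₙ = tₙ₊₁` (the approximants of `[t]` along the
  lifts `û⁺ₙ₋₁` of `tₙ` are `[p]` of those of `[t⁺]`; `[p]` is contracting, hence compatible with Fontaine's limit);
* §3 **`omegaPeriod_ne_zero_of_seq_one_ne_zero`** — if `[p]_W = p·X·R + X^{p²}·S` with `R(0), S(0) ∈ 𝒪_Dˣ` and `e + 2 ≤ p²`,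
  then `∫_t ω ≠ 0` whenever `t₀ = 0` and `t₁ ≠ 0`: otherwise `[t] = 0` (L1′), so `[p][t⁺] = 0`, so `[t⁺] = 0` (L2′), so
  `t₁ = θ_𝒪([t⁺]) = 0`.

Compared with the unramified (N1) (`AinfWeierstrassOmegaPeriodNonvanishing.omegaPeriodHom_ne_zero_of_seq_one_not_mem`, which needs a
VALUATION witness `‖p‖ < ‖t₁‖^p` — false in general over a ramified base, cf. `Lines/kato-lever-hDR-R1-torsion-witness.md`), the
hypothesis here is only `t₁ ≠ 0`: every nonzero Tate-module point not divisible by `p` works. The supersingular shape of `[p]`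
over `𝒪_D` is the coefficient-side input (Silverman AEC IV.7.5 at `a_p = 0`). No definitions, no named facts, no `sorry`.
BSD / K★: the ring side of hypothesis (N1) of `isDeRham_rationalTateRep_curveF_of_tatePtPeriods` for the potentially
supersingular cells; nothing about elliptic curves over number fields is proved here.

## References
* J.-M. Fontaine, *Formes différentielles et modules de Tate…*, Invent. Math. 65 (1982), §5. [Fontaine1982FormesDifferentielles]
* J. H. Silverman, *The Arithmetic of Elliptic Curves* (2009), IV.7.5, IV.3. [SilvermanAEC2009]
* J.-M. Fontaine, Astérisque 223 (1994), Exp. II §1.2.2. [FontaineAsterisque223III]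
-/

noncomputable section

open Ideal Field ValuativeRel Filter Topology

namespace Literature.NumberTheory.PAdicHodge

open Literature.NumberTheory.GaloisRepresentations
open Literature.NumberTheory.GaloisRepresentations.IsNonarchimedeanLocalField
open Literature.NumberTheory.GaloisRepresentations.LubinTate

namespace AinfRamTop

variable {F : Type} [Field F] [ValuativeRel F] [TopologicalSpace F] [IsNonarchimedeanLocalField F] [CharZero F]
  {p : ℕ} [Fact p.Prime] [Fact (¬ IsUnit (p : integerC F))] [IsAdicComplete (Ideal.span {(p : integerC F)}) (integerC F)]
  {hp : valuation F p < 1} {D : EisensteinRoot F p hp}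
  {hθ : Function.Surjective (WittVector.fontaineTheta (integerC F) p)} (W : WeierstrassCurve (EisensteinRoot.CoeffDisc D))

/-! ## §1 `θ_𝒪([t]) = t₀` -/

/-- `θ_𝒪([pⁿ] ûₙ) = [pⁿ] tₙ = t₀` for lifts `ûₙ` of a `[p]`-compatible sequence `t`. [cite: SilvermanAEC2009, IV.3] -/
theorem theta_approx_eq {t : ℕ → (maxNilIdealC F).toIdeal} (htp : ∀ n, mulPC W (t (n + 1)) = t n)
    {u : ℕ → (nilTheta D hθ).toIdeal} (hu : ∀ n, theta D (u n : AinfRamTop D) = t n) (n : ℕ) :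
    theta D (approx (mulP W) u n) = t 0 := by
  rw [approx_def, theta_mulP_iterate]
  have h : (⟨theta D (u n : AinfRamTop D), theta_mem_maxNilIdealC (u n).2⟩ : (maxNilIdealC F).toIdeal) = t (0 + n) :=
    Subtype.ext (by rw [zero_add]; exact hu n)
  rw [h, mulPC_iterate_eq W htp 0 n]

/-- **`θ_𝒪([t]) = t₀`** for every `[p]`-compatible sequence `t` of points of `Ŵ(𝔪_{ℂ_F})` (continuity of `θ_𝒪`; the approximants
all map to `t₀`). [cite: FontaineAsterisque223III, Exp. II §1.2.2] -/
theorem theta_torsionLift_eq {t : ℕ → (maxNilIdealC F).toIdeal} (htp : ∀ n, mulPC W (t (n + 1)) = t n) :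
    theta D (torsionLift W hθ t htp) = t 0 := by
  have h1 : Tendsto (fun n => theta D (approx (mulP W) (lift D hθ t) n)) atTop (𝓝 (theta D (torsionLift W hθ t htp))) :=
    ((continuous_theta (D := D)).tendsto _).comp (tendsto_torsionLift W htp (theta_lift t))
  have h2 : (fun n => theta D (approx (mulP W) (lift D hθ t) n)) = fun _ => (t 0 : CBall F) :=
    funext fun n => theta_approx_eq W htp (theta_lift t) n
  rw [h2] at h1
  exact tendsto_nhds_unique h1 tendsto_const_nhds

/-! ## §2 `[p]·[t⁺] = [t]` for the shifted sequence -/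

omit [Fact (¬ IsUnit (p : integerC F))] [IsAdicComplete (Ideal.span {(p : integerC F)}) (integerC F)] in
/-- The shifted sequence `t⁺ₙ = tₙ₊₁` is `[p]`-compatible. [cite: SilvermanAEC2009, IV.3] -/
theorem mulPC_shift {t : ℕ → (maxNilIdealC F).toIdeal} (htp : ∀ n, mulPC W (t (n + 1)) = t n) (n : ℕ) :
    mulPC W (t (n + 1 + 1)) = t (n + 1) := htp (n + 1)

/-- **`[p]·[t⁺] = [t]`**: multiplication by `p` on `Ŵ(𝔫_𝒪)` maps Fontaine's element of the shifted sequence `t⁺ₙ = tₙ₊₁` to that of `t`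
(no hypothesis on `t₀`). Proof: with lifts `û⁺ₙ` of `tₙ₊₁`, the sequence `u₀ = [p]û⁺₀`, `uₙ₊₁ = û⁺ₙ` lifts `t`, its approximants are
`[pⁿ⁺¹]û⁺ₙ = [p]([pⁿ]û⁺ₙ)`, and `[p]` is contracting, so `[p][t⁺]` satisfies the characterisation of `[t]`.
[cite: FontaineAsterisque223III, Exp. II §1.2.2] [cite: SilvermanAEC2009, IV.3] -/
theorem mulP_torsionLift_shift {t : ℕ → (maxNilIdealC F).toIdeal} (htp : ∀ n, mulPC W (t (n + 1)) = t n) :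
    (mulP W ⟨torsionLift W hθ (fun n => t (n + 1)) (mulPC_shift W htp), flim_mem_nilTheta _ _⟩ : AinfRamTop D) =
      torsionLift W hθ t htp := by
  set t' : ℕ → (maxNilIdealC F).toIdeal := fun n => t (n + 1) with ht'
  have htp' : ∀ n, mulPC W (t' (n + 1)) = t' n := mulPC_shift W htp
  -- the approximating points `aₙ = [pⁿ] û⁺ₙ` of `[t⁺]`
  set a : ℕ → (nilTheta D hθ).toIdeal := fun n => (mulP W)^[n] (lift D hθ t' n) with hadef
  have ha : ∀ n, approx (mulP W) (lift D hθ t') n = (a n : AinfRamTop D) := fun n => rfl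
  -- lifts of `t`: `u 0 = [p] û⁺₀`, `u (n+1) = û⁺ₙ`
  set u : ℕ → (nilTheta D hθ).toIdeal := fun n => Nat.casesOn n (mulP W (lift D hθ t' 0)) fun m => lift D hθ t' m with hudef
  have hu : ∀ n, theta D (u n : AinfRamTop D) = t n := by
    intro n
    cases n with
    | zero =>
      change theta D (mulP W (lift D hθ t' 0) : AinfRamTop D) = t 0
      rw [theta_mulP]
      have h : (⟨theta D (lift D hθ t' 0 : AinfRamTop D), theta_mem_maxNilIdealC (lift D hθ t' 0).2⟩ : (maxNilIdealC F).toIdeal) =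
          t' 0 := Subtype.ext (theta_lift t' 0)
      rw [h]; exact congrArg Subtype.val (htp 0)
    | succ m => exact theta_lift t' m
  -- approximants of `[t]` along `u`: `approx u n = [p](a (n - 1))`
  have happrox : ∀ n, approx (mulP W) u n = (mulP W (a (n - 1)) : AinfRamTop D) := by
    intro n
    cases n with
    | zero => rfl
    | succ m =>
      rw [approx_def, Function.iterate_succ_apply', Nat.add_sub_cancel]
  rw [torsionLift_eq_flim W htp hu]
  refine eq_flim_of_forall_sub_mem (isContracting_mulP (hθ := hθ) W) (mulP_lift_sub_mem W htp hu) fun n => ?_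
  rw [happrox n]
  -- `[t⁺] − a (n-1) ∈ 𝔦^n`, so `[p]` of both differ by an element of `𝔦^(n+1)`
  have hmem : ((⟨torsionLift W hθ t' htp', flim_mem_nilTheta (isContracting_mulP (hθ := hθ) W)
      (mulP_lift_sub_mem W htp' (theta_lift t'))⟩ : (nilTheta D hθ).toIdeal) : AinfRamTop D) - a (n - 1) ∈
      (WithIdeal.i ^ (n - 1 + 1) : Ideal (AinfRamTop D)) := by
    rw [← ha]
    exact flim_sub_approx_mem (isContracting_mulP (hθ := hθ) W) (mulP_lift_sub_mem W htp' (theta_lift t')) (n - 1)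
  have h := isContracting_mulP (hθ := hθ) W (n - 1) _ _ hmem
  rcases n with _ | n
  · exact Ideal.pow_le_pow_right (by omega) h
  · simpa using h

/-! ## §3 (N1′): `∫_t ω ≠ 0` when `t₁ ≠ 0` -/

/-- **(N1′) over the ramified base**: if `[p]_W = p·X·R + X^{p²}·S` with `R(0), S(0) ∈ 𝒪_Dˣ` (supersingular shape) and
`e + 2 ≤ p²`, then for every `[p]`-compatible sequence `t` of points of `Ŵ(𝔪_{ℂ_F})` with `t₀ = 0` and `t₁ ≠ 0`, the ω-period
`∫_t ω = log_W(ι_𝒪[t]) ∈ B_dR⁺` is NONZERO: `∫_t ω = 0 ⟹ [t] = 0` (L1′) `⟹ [p][t⁺] = 0 ⟹ [t⁺] = 0` (L2′) `⟹ t₁ = θ_𝒪([t⁺]) = 0`.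
[cite: Fontaine1982FormesDifferentielles, §5] [cite: SilvermanAEC2009, IV.7.5] -/
theorem omegaPeriod_ne_zero_of_seq_one_ne_zero {R S : PowerSeries (EisensteinRoot.CoeffDisc D)}
    (hshape : W.formalMul p = (p : PowerSeries (EisensteinRoot.CoeffDisc D)) * PowerSeries.X * R + PowerSeries.X ^ (p ^ 2) * S)
    (hR : IsUnit (PowerSeries.constantCoeff R)) (hS : IsUnit (PowerSeries.constantCoeff S)) (he : D.e + 2 ≤ p ^ 2)
    {t : ℕ → (maxNilIdealC F).toIdeal} (ht0 : (t 0 : CBall F) = 0) (htp : ∀ n, mulPC W (t (n + 1)) = t n)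
    (h1 : (t 1 : CBall F) ≠ 0) : omegaPeriod W hθ t ht0 htp ≠ 0 := by
  intro h
  have hL1 : torsionLift W hθ t htp = 0 := torsionLift_eq_zero_of_omegaPeriod_eq_zero W ht0 htp h
  have hmul0 : (mulP W ⟨torsionLift W hθ (fun n => t (n + 1)) (mulPC_shift W htp), flim_mem_nilTheta _ _⟩ : AinfRamTop D) = 0 :=
    (mulP_torsionLift_shift W (hθ := hθ) htp).trans hL1
  have hL2 : torsionLift W hθ (fun n => t (n + 1)) (mulPC_shift W htp) = 0 :=
    torsionLift_eq_zero_of_mulP_eq_zero W hshape hR hS he (t := fun n => t (n + 1)) (mulPC_shift W htp) hmul0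
  have hθ1 : theta D (torsionLift W hθ (fun n => t (n + 1)) (mulPC_shift W htp)) = t (0 + 1) :=
    theta_torsionLift_eq W (hθ := hθ) (t := fun n => t (n + 1)) (mulPC_shift W htp)
  rw [hL2, map_zero, zero_add] at hθ1
  exact h1 hθ1.symm

end AinfRamTop

end Literature.NumberTheory.PAdicHodge

end
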